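import Summits.Ventures.LatticeQCDFlow.Exactness.IMHCommonRandomNumbersMeetingTimeTwoStarts
import HarnessLib

/-!
# The exact law of the meeting time from EVERY initial coupling: `P(X_n ≠ X′_n) = E[(1 − A(heavier start))ⁿ ; X_0 ≠ X′_0]` — a mixture of
# geometric laws whose parameter is the acceptance probability at the heavier of the two starting configurations — and `E[T] = E[1/A(heavier start) ; X_0 ≠ X′_0]`

HONEST FRAMING: exact (Metropolis-corrected) sampling algorithms for lattice gauge theory;
figures of merit are autocorrelation/cost numbers at stated couplings and volumes; no
continuum-physics claim.

Venture `LatticeQCDFlow` (cell pub-lqcd), topic `Exactness`; FANOUT row 30 (lean-1, GEN-39).  NEW WORK of the cell; sequel to this generation's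
`…MeetingTimeTwoStarts` (first run at a POINT `x`, second run lighter: `P(X_n ≠ X′_n) = (1 − A(x))ⁿ`, `A(x) = imhAcceptMass q w x`; swap symmetry)
and `…MeetingTimeGeometric` (`P(T ≥ t) = P(X_{t−1} ≠ X′_{t−1})`).  Here the starting pair is RANDOM.  Standard Borel configuration space, atom-free
proposal (`q{x} = 0` for every `x`), common-random-numbers pair kernel `K̂` of `K = indepMH q w`; `O = {p | w p.2 ≤ w p.1}` (first run heavier or equal):

* §1 (linearity of the pair law in the initial coupling) **`iterate_bind_add`**, **`iterate_bind_comp`** ∕ **`iterate_comp_apply`** — `n` shared updates from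
  `μ + ν`, from `κ ∘ₘ μ₁`; **`iterate_bind_crnPair_offDiagonal_eq_zero_of_diag`** — a coupling carried by the diagonal stays there.
* §2 **`iterate_bind_crnPair_offDiagonal_eq_mixture`** — ORDERED RANDOM START: for `μ̂₀ = μ₁ ⊗ₘ κ` with `κ x` carried by `{y | w y ≤ w x, y ≠ x}` for
  `μ₁`-a.e. `x`: `P(X_n ≠ X′_n) = ∫ (1 − A(x))ⁿ dμ₁(x)` EXACTLY — a `μ₁`-mixture of geometric laws.
* §3 **`iterate_bind_crnPair_offDiagonal_eq_lintegral_fst`** — every finite measure `ρ` on pairs carried by `Δᶜ ∩ O` (disintegration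
  `ρ = ρ.fst ⊗ₘ ρ.condKernel`, Mathlib): `(ρK̂ⁿ)(Δᶜ) = ∫ (1 − A(p.1))ⁿ dρ(p)`;
  **`iterate_bind_crnPair_offDiagonal_eq_anyCoupling`** — EVERY INITIAL COUPLING `μ̂₀` (a probability measure on pairs):
  `P(X_n ≠ X′_n) = ∫_{Δᶜ ∩ O} (1 − A(p.1))ⁿ dμ̂₀ + ∫_{Δᶜ ∩ Oᶜ} (1 − A(p.2))ⁿ dμ̂₀ = E[(1 − A(heavier of X_0, X′_0))ⁿ ; X_0 ≠ X′_0]`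
  (the diagonal part contributes nothing, the unordered part is the ordered part of the swapped coupling).
* §4 **`crn_chain_totalDisagreement_tail_eq_anyCoupling`** — hence, `w` normalised and maximal at some `x₀`: `P(T ≥ t)` equals the same mixture at `n = t − 1`
  for every `t ≥ 1`: THE MEETING TIME OF TWO COUPLED EXACT SAMPLERS IS A MIXTURE OF GEOMETRIC LAWS WITH PARAMETER THE ACCEPTANCE PROBABILITY AT THE
  HEAVIER START, FROM EVERY INITIAL COUPLING.
* §5 **`tsum_iterate_bind_crnPair_offDiagonal_eq_anyCoupling`** — `Σ_n P(X_n ≠ X′_n) = ∫_{O ∩ Δᶜ} A(p.1)⁻¹ dμ̂₀ + ∫_{Oᶜ ∩ Δᶜ} A(p.2)⁻¹ dμ̂₀` (`Σ_n (1 − a)ⁿ = 1/a`,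
  Tonelli); **`crn_chain_integral_totalDisagreement_eq_anyCoupling`** — `E[T] = E[1/A(heavier of X_0, X′_0) ; X_0 ≠ X′_0]` EXACTLY (GEN-38's `E[T] = Σ_n P(X_n ≠ X′_n)`):
  the expected number of updates on which two coupled exact samplers differ is the expected INVERSE acceptance probability at the heavier start (GEN-37's bound
  `≤ P(X_0 ≠ X′_0)·W` is the case `A(·) ≥ 1/W`).
Reading (gauge files): two exact gauge samplers on one stream of random numbers, started any way at all, differ for a number of updates whose law is the
average, over the starting pair, of geometric laws with parameter the sampler's acceptance at the heavier starting configuration.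
NOT CLAIMED: proposals with atoms (finite `G`); higher moments (the same computation with `Σ_n (2n + 1)(1 − a)ⁿ`); finiteness of `E[T]` without a positive lower
bound on `A(·)`; any value of `A(x)`.  No `sorry`, no new
definitions, nothing cited as a fact.
-/

noncomputable section

namespace Summit.Ventures.LatticeQCDFlow.Exactness

open MeasureTheory ProbabilityTheory Function Finset Filter Set
open scoped ENNReal unitInterval Topology
open Summit.Ventures.LatticeQCDFlow.Scoring

variable {Ω : Type*} [MeasurableSpace Ω] {q : Measure Ω} [IsProbabilityMeasure q] {w : Ω → ℝ}

/-! ## §1 Linearity of the pair law in the initial coupling; the diagonal is absorbing -/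

omit [IsProbabilityMeasure q] in
/-- `n` steps from `μ + ν` are `n` steps from `μ` plus `n` steps from `ν`. [ours, bookkeeping] -/
theorem iterate_bind_add {α : Type*} [MeasurableSpace α] (K : Kernel α α) :
    ∀ (n : ℕ) (μ ν : Measure α), (fun m : Measure α => m.bind K)^[n] (μ + ν) =
      (fun m : Measure α => m.bind K)^[n] μ + (fun m : Measure α => m.bind K)^[n] ν
  | 0, μ, ν => rfl
  | n + 1, μ, ν => by
    have hstep : (μ + ν).bind K = μ.bind K + ν.bind K := by
      ext s hs
      rw [Measure.bind_apply hs (Kernel.aemeasurable _), Measure.add_apply, Measure.bind_apply hs (Kernel.aemeasurable _),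
        Measure.bind_apply hs (Kernel.aemeasurable _), lintegral_add_measure]
    rw [Function.iterate_succ_apply, Function.iterate_succ_apply, Function.iterate_succ_apply, hstep, iterate_bind_add K n]

omit [IsProbabilityMeasure q] in
/-- Pointwise: the `n`-fold kernel iteration applied at `x` is `n` steps from `κ x`. [ours, bookkeeping] -/
theorem iterate_comp_apply {α β : Type*} [MeasurableSpace α] [MeasurableSpace β] (K : Kernel β β) (κ : Kernel α β) :
    ∀ (n : ℕ) (x : α), ((fun κ' : Kernel α β => K ∘ₖ κ')^[n] κ) x = (fun m : Measure β => m.bind K)^[n] (κ x)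
  | 0, x => rfl
  | n + 1, x => by
    rw [Function.iterate_succ_apply', Function.iterate_succ_apply', Kernel.comp_apply, iterate_comp_apply K κ n x]

omit [IsProbabilityMeasure q] in
/-- `n` steps from `κ ∘ₘ μ₁` are the composition of `μ₁` with the `n`-fold iterated kernel. [ours, bookkeeping] -/
theorem iterate_bind_comp {α β : Type*} [MeasurableSpace α] [MeasurableSpace β] (K : Kernel β β) :
    ∀ (n : ℕ) (κ : Kernel α β) (μ₁ : Measure α), (fun m : Measure β => m.bind K)^[n] (κ ∘ₘ μ₁) =
      ((fun κ' : Kernel α β => K ∘ₖ κ')^[n] κ) ∘ₘ μ₁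
  | 0, κ, μ₁ => rfl
  | n + 1, κ, μ₁ => by
    rw [Function.iterate_succ_apply, Function.iterate_succ_apply]
    have h : (κ ∘ₘ μ₁).bind K = (K ∘ₖ κ) ∘ₘ μ₁ := Measure.comp_assoc
    rw [h, iterate_bind_comp K n]

/-- **A COUPLING CARRIED BY THE DIAGONAL STAYS ON THE DIAGONAL**: `ν(Δᶜ) = 0 ⇒ (νK̂ⁿ)(Δᶜ) = 0`. [ours] -/
theorem iterate_bind_crnPair_offDiagonal_eq_zero_of_diag [MeasurableEq Ω] (hw : Measurable w) (hw0 : ∀ y, 0 < w y)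
    (Khat : Kernel (Ω × Ω) (Ω × Ω)) [IsMarkovKernel Khat]
    (hK : ∀ z : Ω × Ω, Khat z = (q.prod (volume : Measure unitInterval)).map (fun p : Ω × unitInterval =>
      ((if (p.2 : ℝ) * w z.1 ≤ w p.1 then p.1 else z.1), (if (p.2 : ℝ) * w z.2 ≤ w p.1 then p.1 else z.2)))) :
    ∀ (n : ℕ) (ν : Measure (Ω × Ω)), ν (Set.diagonal Ω)ᶜ = 0 → ((fun m : Measure (Ω × Ω) => m.bind Khat)^[n] ν) (Set.diagonal Ω)ᶜ = 0
  | 0, ν, h => h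
  | n + 1, ν, h => by
    rw [Function.iterate_succ_apply]
    refine iterate_bind_crnPair_offDiagonal_eq_zero_of_diag hw hw0 Khat hK n (ν.bind Khat) ?_
    rw [Measure.bind_apply (measurableSet_diagonal (α := Ω)).compl (Kernel.aemeasurable _)]
    have hae : ∀ᵐ z ∂ν, Khat z (Set.diagonal Ω)ᶜ = 0 := by
      filter_upwards [measure_eq_zero_iff_ae_notMem.1 h] with z hz
      have hz' : z.1 = z.2 := Set.mem_diagonal_iff.1 (not_not.1 (fun h' => hz h'))
      have hzz : z = (z.1, z.1) := Prod.ext rfl hz'.symm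
      rw [hzz]; exact crnPair_diag_offDiagonal_eq_zero hw hw0 Khat hK z.1
    rw [lintegral_congr_ae hae, lintegral_zero]

/-! ## §2 Ordered random start: a mixture of geometric laws -/

/-- **ORDERED RANDOM START**: `μ̂₀ = μ₁ ⊗ₘ κ` with, for `μ₁`-a.e. `x`, `κ x` carried by the lighter-or-equal configurations and `κ x {x} = 0`; atom-free
proposal.  Then `P(X_n ≠ X′_n) = ∫ (1 − A(x))ⁿ dμ₁(x)` EXACTLY, every `n`. [ours] -/
theorem iterate_bind_crnPair_offDiagonal_eq_mixture [MeasurableSingletonClass Ω] [MeasurableEq Ω] (hw : Measurable w)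
    (hw0 : ∀ y, 0 < w y) (hq : ∀ x, q {x} = 0) (Khat : Kernel (Ω × Ω) (Ω × Ω)) [IsMarkovKernel Khat]
    (hK : ∀ z : Ω × Ω, Khat z = (q.prod (volume : Measure unitInterval)).map (fun p : Ω × unitInterval =>
      ((if (p.2 : ℝ) * w z.1 ≤ w p.1 then p.1 else z.1), (if (p.2 : ℝ) * w z.2 ≤ w p.1 then p.1 else z.2))))
    (n : ℕ) (μ₁ : Measure Ω) [SFinite μ₁] (κ : Kernel Ω Ω) [IsMarkovKernel κ]
    (hκord : ∀ᵐ x ∂μ₁, κ x {y | w y ≤ w x} = 1) (hκx : ∀ᵐ x ∂μ₁, κ x {x} = 0) :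
    ((fun m : Measure (Ω × Ω) => m.bind Khat)^[n] (μ₁ ⊗ₘ κ)) (Set.diagonal Ω)ᶜ = ∫⁻ x, (1 - imhAcceptMass q w x) ^ n ∂μ₁ := by
  have hD : MeasurableSet (Set.diagonal Ω)ᶜ := (measurableSet_diagonal (α := Ω)).compl
  rw [Measure.compProd_eq_comp_prod, iterate_bind_comp Khat n (Kernel.id ×ₖ κ) μ₁, Measure.bind_apply hD (Kernel.aemeasurable _)]
  refine lintegral_congr_ae ?_
  filter_upwards [hκord, hκx] with x hx1 hx2
  rw [iterate_comp_apply Khat (Kernel.id ×ₖ κ) n x, Kernel.prod_apply, Kernel.id_apply, Measure.dirac_prod]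
  haveI : IsProbabilityMeasure ((κ x).map (Prod.mk x)) := Measure.isProbabilityMeasure_map measurable_prodMk_left.aemeasurable
  refine iterate_bind_crnPair_offDiagonal_ennreal_eq_holding hw hw0 (hq x) Khat hK n ((κ x).map (Prod.mk x)) ?_ ?_ ?_
  · rw [Measure.map_map measurable_fst measurable_prodMk_left]
    show (κ x).map (fun _ => x) = Measure.dirac x
    rw [Measure.map_const, measure_univ, one_smul]
  · have hOm : MeasurableSet {p : Ω × Ω | w p.2 ≤ w p.1} := measurableSet_le (hw.comp measurable_snd) (hw.comp measurable_fst)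
    rw [Measure.map_apply measurable_prodMk_left hOm]
    exact hx1
  · rw [Measure.map_map measurable_snd measurable_prodMk_left]
    show (κ x).map (fun y => y) {x} = 0
    rw [Measure.map_id']; exact hx2

/-! ## §3 Every initial coupling -/

/-- **A FINITE MEASURE ON PAIRS CARRIED BY THE ORDERED OFF-DIAGONAL SET**: `ρ(Δ) = 0`, `ρ(Oᶜ) = 0` (standard Borel, atom-free proposal) ⇒
`(ρK̂ⁿ)(Δᶜ) = ∫ (1 − A(p.1))ⁿ dρ(p)` (disintegration along the first coordinate). [ours] -/
theorem iterate_bind_crnPair_offDiagonal_eq_lintegral_fst [StandardBorelSpace Ω] [Nonempty Ω] [MeasurableSingletonClass Ω] [MeasurableEq Ω]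
    (hw : Measurable w) (hw0 : ∀ y, 0 < w y) (hq : ∀ x, q {x} = 0) (Khat : Kernel (Ω × Ω) (Ω × Ω)) [IsMarkovKernel Khat]
    (hK : ∀ z : Ω × Ω, Khat z = (q.prod (volume : Measure unitInterval)).map (fun p : Ω × unitInterval =>
      ((if (p.2 : ℝ) * w z.1 ≤ w p.1 then p.1 else z.1), (if (p.2 : ℝ) * w z.2 ≤ w p.1 then p.1 else z.2))))
    (n : ℕ) (ρ : Measure (Ω × Ω)) [IsFiniteMeasure ρ] (hΔ : ρ (Set.diagonal Ω) = 0) (hO : ρ {p : Ω × Ω | w p.2 ≤ w p.1}ᶜ = 0) :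
    ((fun m : Measure (Ω × Ω) => m.bind Khat)^[n] ρ) (Set.diagonal Ω)ᶜ = ∫⁻ p, (1 - imhAcceptMass q w p.1) ^ n ∂ρ := by
  have hOm : MeasurableSet {p : Ω × Ω | w p.2 ≤ w p.1} := measurableSet_le (hw.comp measurable_snd) (hw.comp measurable_fst)
  have hAm : Measurable fun x : Ω => (1 - imhAcceptMass q w x) ^ n := (measurable_const.sub (measurable_imhAcceptMass q hw)).pow_const n
  -- disintegrate `ρ` along the first coordinate
  have hdis : ρ.fst ⊗ₘ ρ.condKernel = ρ := ρ.disintegrate ρ.condKernel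
  -- the fibres are carried by the lighter-or-equal configurations and avoid the base point
  have hκord : ∀ᵐ x ∂ρ.fst, ρ.condKernel x {y | w y ≤ w x} = 1 := by
    have h0 : ∫⁻ x, ρ.condKernel x (Prod.mk x ⁻¹' {p : Ω × Ω | w p.2 ≤ w p.1}ᶜ) ∂ρ.fst = 0 := by
      rw [← Measure.compProd_apply hOm.compl, hdis]; exact hO
    have hae := (lintegral_eq_zero_iff (Kernel.measurable_kernel_prodMk_left hOm.compl)).1 h0
    filter_upwards [hae] with x hx
    have hx' : ρ.condKernel x {y | w y ≤ w x}ᶜ = 0 := hx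
    rw [← prob_add_prob_compl (μ := ρ.condKernel x) (measurableSet_le hw measurable_const : MeasurableSet {y | w y ≤ w x}), hx', add_zero]
  have hκx : ∀ᵐ x ∂ρ.fst, ρ.condKernel x {x} = 0 := by
    have h0 : ∫⁻ x, ρ.condKernel x (Prod.mk x ⁻¹' Set.diagonal Ω) ∂ρ.fst = 0 := by
      rw [← Measure.compProd_apply (measurableSet_diagonal (α := Ω)), hdis]; exact hΔ
    have hae := (lintegral_eq_zero_iff (Kernel.measurable_kernel_prodMk_left (measurableSet_diagonal (α := Ω)))).1 h0
    filter_upwards [hae] with x hx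
    have hset : Prod.mk x ⁻¹' Set.diagonal Ω = {x} := by
      ext y; simp [Set.mem_diagonal_iff, eq_comm]
    rw [← hset]; exact hx
  have hL : ((fun m : Measure (Ω × Ω) => m.bind Khat)^[n] ρ) (Set.diagonal Ω)ᶜ =
      ((fun m : Measure (Ω × Ω) => m.bind Khat)^[n] (ρ.fst ⊗ₘ ρ.condKernel)) (Set.diagonal Ω)ᶜ := by rw [hdis]
  rw [hL, iterate_bind_crnPair_offDiagonal_eq_mixture hw hw0 hq Khat hK n ρ.fst ρ.condKernel hκord hκx, Measure.fst,
    lintegral_map hAm measurable_fst]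

/-- **THE EXACT ONE-TIME DISAGREEMENT PROBABILITY FROM EVERY INITIAL COUPLING**: standard Borel `Ω`, atom-free proposal; for every finite
measure `μ̂₀` on pairs (in particular every initial coupling) and every `n`,
`(μ̂₀K̂ⁿ)(Δᶜ) = ∫_{O ∩ Δᶜ} (1 − A(p.1))ⁿ dμ̂₀ + ∫_{Oᶜ ∩ Δᶜ} (1 − A(p.2))ⁿ dμ̂₀` — the expectation, over the starting pairs that differ, of
`(1 − A(heavier start))ⁿ` (`O = {w p.2 ≤ w p.1}`). [ours] -/
theorem iterate_bind_crnPair_offDiagonal_eq_anyCoupling [StandardBorelSpace Ω] [Nonempty Ω] [MeasurableSingletonClass Ω] [MeasurableEq Ω]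
    (hw : Measurable w) (hw0 : ∀ y, 0 < w y) (hq : ∀ x, q {x} = 0) (Khat : Kernel (Ω × Ω) (Ω × Ω)) [IsMarkovKernel Khat]
    (hK : ∀ z : Ω × Ω, Khat z = (q.prod (volume : Measure unitInterval)).map (fun p : Ω × unitInterval =>
      ((if (p.2 : ℝ) * w z.1 ≤ w p.1 then p.1 else z.1), (if (p.2 : ℝ) * w z.2 ≤ w p.1 then p.1 else z.2))))
    (n : ℕ) (μ₀ : Measure (Ω × Ω)) [IsFiniteMeasure μ₀] :
    ((fun m : Measure (Ω × Ω) => m.bind Khat)^[n] μ₀) (Set.diagonal Ω)ᶜ =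
      ∫⁻ p in {p : Ω × Ω | w p.2 ≤ w p.1} ∩ (Set.diagonal Ω)ᶜ, (1 - imhAcceptMass q w p.1) ^ n ∂μ₀ +
        ∫⁻ p in {p : Ω × Ω | w p.2 ≤ w p.1}ᶜ ∩ (Set.diagonal Ω)ᶜ, (1 - imhAcceptMass q w p.2) ^ n ∂μ₀ := by
  have hD : MeasurableSet (Set.diagonal Ω) := measurableSet_diagonal
  have hOm : MeasurableSet {p : Ω × Ω | w p.2 ≤ w p.1} := measurableSet_le (hw.comp measurable_snd) (hw.comp measurable_fst)
  have hAm : Measurable fun x : Ω => (1 - imhAcceptMass q w x) ^ n := (measurable_const.sub (measurable_imhAcceptMass q hw)).pow_const n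
  -- split the coupling into its diagonal, ordered off-diagonal and unordered off-diagonal parts
  have hsplit : μ₀ = μ₀.restrict (Set.diagonal Ω) +
      (μ₀.restrict ({p : Ω × Ω | w p.2 ≤ w p.1} ∩ (Set.diagonal Ω)ᶜ) + μ₀.restrict ({p : Ω × Ω | w p.2 ≤ w p.1}ᶜ ∩ (Set.diagonal Ω)ᶜ)) := by
    rw [← Measure.restrict_restrict hOm, ← Measure.restrict_restrict hOm.compl, Measure.restrict_add_restrict_compl hOm,
      Measure.restrict_add_restrict_compl hD]
  -- (1) the diagonal part never leaves the diagonal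
  have h1 : ((fun m : Measure (Ω × Ω) => m.bind Khat)^[n] (μ₀.restrict (Set.diagonal Ω))) (Set.diagonal Ω)ᶜ = 0 :=
    iterate_bind_crnPair_offDiagonal_eq_zero_of_diag hw hw0 Khat hK n _ (by
      rw [Measure.restrict_apply hD.compl, Set.compl_inter_self, measure_empty])
  -- (2) the ordered off-diagonal part
  have h2 : ((fun m : Measure (Ω × Ω) => m.bind Khat)^[n] (μ₀.restrict ({p : Ω × Ω | w p.2 ≤ w p.1} ∩ (Set.diagonal Ω)ᶜ))) (Set.diagonal Ω)ᶜ =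
      ∫⁻ p in {p : Ω × Ω | w p.2 ≤ w p.1} ∩ (Set.diagonal Ω)ᶜ, (1 - imhAcceptMass q w p.1) ^ n ∂μ₀ :=
    iterate_bind_crnPair_offDiagonal_eq_lintegral_fst hw hw0 hq Khat hK n _
      (by rw [Measure.restrict_apply hD]; exact measure_mono_null (fun p hp => hp.2.2 hp.1) (measure_empty (μ := μ₀)))
      (by rw [Measure.restrict_apply hOm.compl]; exact measure_mono_null (fun p hp => hp.1 hp.2.1) (measure_empty (μ := μ₀)))
  -- (3) the unordered off-diagonal part is the ordered part of the swapped measure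
  have h3 : ((fun m : Measure (Ω × Ω) => m.bind Khat)^[n] (μ₀.restrict ({p : Ω × Ω | w p.2 ≤ w p.1}ᶜ ∩ (Set.diagonal Ω)ᶜ))) (Set.diagonal Ω)ᶜ =
      ∫⁻ p in {p : Ω × Ω | w p.2 ≤ w p.1}ᶜ ∩ (Set.diagonal Ω)ᶜ, (1 - imhAcceptMass q w p.2) ^ n ∂μ₀ := by
    set C := μ₀.restrict ({p : Ω × Ω | w p.2 ≤ w p.1}ᶜ ∩ (Set.diagonal Ω)ᶜ) with hC
    have hpre : Prod.swap ⁻¹' (Set.diagonal Ω)ᶜ = (Set.diagonal Ω)ᶜ := by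
      ext p; simp [Set.mem_diagonal_iff, eq_comm]
    have hswap : ((fun m : Measure (Ω × Ω) => m.bind Khat)^[n] C) (Set.diagonal Ω)ᶜ =
        ((fun m : Measure (Ω × Ω) => m.bind Khat)^[n] (C.map Prod.swap)) (Set.diagonal Ω)ᶜ := by
      rw [iterate_bind_crnPair_swap hw Khat hK n C, Measure.map_apply measurable_swap hD.compl, hpre]
    rw [hswap]
    have hCΔ : (C.map Prod.swap) (Set.diagonal Ω) = 0 := by
      rw [Measure.map_apply measurable_swap hD, hC, Measure.restrict_apply (measurable_swap hD)]
      exact measure_mono_null (fun p hp => hp.2.2 (by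
        have h := hp.1; rw [Set.mem_preimage, Set.mem_diagonal_iff] at h; exact Set.mem_diagonal_iff.2 h.symm)) (measure_empty (μ := μ₀))
    have hCO : (C.map Prod.swap) {p : Ω × Ω | w p.2 ≤ w p.1}ᶜ = 0 := by
      rw [Measure.map_apply measurable_swap hOm.compl, hC, Measure.restrict_apply (measurable_swap hOm.compl)]
      refine measure_mono_null (fun p hp => ?_) (measure_empty (μ := μ₀))
      have h1' : ¬ w p.1 ≤ w p.2 := hp.1
      have h2' : ¬ w p.2 ≤ w p.1 := hp.2.1
      exact absurd (le_of_lt (not_le.1 h1')) h2'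
    have hAm1 : Measurable fun p : Ω × Ω => (1 - imhAcceptMass q w p.1) ^ n := hAm.comp measurable_fst
    rw [iterate_bind_crnPair_offDiagonal_eq_lintegral_fst hw hw0 hq Khat hK n _ hCΔ hCO, lintegral_map hAm1 measurable_swap]
    rfl
  have hL : ((fun m : Measure (Ω × Ω) => m.bind Khat)^[n] μ₀) (Set.diagonal Ω)ᶜ =
      ((fun m : Measure (Ω × Ω) => m.bind Khat)^[n] (μ₀.restrict (Set.diagonal Ω) +
        (μ₀.restrict ({p : Ω × Ω | w p.2 ≤ w p.1} ∩ (Set.diagonal Ω)ᶜ) +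
          μ₀.restrict ({p : Ω × Ω | w p.2 ≤ w p.1}ᶜ ∩ (Set.diagonal Ω)ᶜ)))) (Set.diagonal Ω)ᶜ := by
    rw [← hsplit]
  rw [hL, iterate_bind_add Khat n, iterate_bind_add Khat n, Measure.add_apply, Measure.add_apply, h1, h2, h3, zero_add]

/-! ## §4 The law of the meeting time from every initial coupling -/

/-- **THE MEETING TIME IS A MIXTURE OF GEOMETRIC LAWS, FROM EVERY INITIAL COUPLING**: standard Borel `Ω`, atom-free proposal, `w` normalised and
maximal at some `x₀`; for every initial coupling `μ̂₀` and every `t ≥ 1`,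
`P(T ≥ t) = ∫_{O ∩ Δᶜ} (1 − A(p.1))^{t−1} dμ̂₀ + ∫_{Oᶜ ∩ Δᶜ} (1 − A(p.2))^{t−1} dμ̂₀` (as the real value of the extended-real sum). [ours] -/
theorem crn_chain_totalDisagreement_tail_eq_anyCoupling [StandardBorelSpace Ω] [Nonempty Ω] [MeasurableSingletonClass Ω] [MeasurableEq Ω]
    (hw : Measurable w) (hw0 : ∀ y, 0 < w y) {x₀ : Ω} (hmax : ∀ y, w y ≤ w x₀) [IsProbabilityMeasure (q.withDensity fun y => ENNReal.ofReal (w y))]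
    (hq : ∀ x, q {x} = 0) (Khat : Kernel (Ω × Ω) (Ω × Ω)) [IsMarkovKernel Khat]
    (hK : ∀ z : Ω × Ω, Khat z = (q.prod (volume : Measure unitInterval)).map (fun p : Ω × unitInterval =>
      ((if (p.2 : ℝ) * w z.1 ≤ w p.1 then p.1 else z.1), (if (p.2 : ℝ) * w z.2 ≤ w p.1 then p.1 else z.2))))
    (μ₀ : Measure (Ω × Ω)) [IsProbabilityMeasure μ₀] {t : ℕ} (ht : 1 ≤ t) :
    (Kernel.trajMeasure (X := fun _ : ℕ => Ω × Ω) μ₀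
          (fun n : ℕ => Khat.comap (fun h : (i : ↥(Finset.Iic n)) → Ω × Ω => h ⟨n, Finset.mem_Iic.2 le_rfl⟩)
            (measurable_pi_apply _))).real
        {z | (t : ℝ) ≤ ∑' n, (Set.diagonal Ω)ᶜ.indicator (1 : Ω × Ω → ℝ) (z n)} =
      (∫⁻ p in {p : Ω × Ω | w p.2 ≤ w p.1} ∩ (Set.diagonal Ω)ᶜ, (1 - imhAcceptMass q w p.1) ^ (t - 1) ∂μ₀ +
        ∫⁻ p in {p : Ω × Ω | w p.2 ≤ w p.1}ᶜ ∩ (Set.diagonal Ω)ᶜ, (1 - imhAcceptMass q w p.2) ^ (t - 1) ∂μ₀).toReal := by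
  rw [crn_chain_totalDisagreement_tail_eq hw hw0 hmax Khat hK μ₀ ht, measureReal_def,
    iterate_bind_crnPair_offDiagonal_eq_anyCoupling hw hw0 hq Khat hK (t - 1) μ₀]

/-! ## §5 The expected meeting time: summing the mixture of geometric laws -/

/-- `Σ_n (1 − a)ⁿ = a⁻¹` in `ℝ≥0∞` for `a ≤ 1`. [ours, bookkeeping] -/
theorem ENNReal.tsum_one_sub_pow_eq_inv {a : ℝ≥0∞} (ha : a ≤ 1) : ∑' n : ℕ, (1 - a) ^ n = a⁻¹ := by
  rw [ENNReal.tsum_geometric, ENNReal.sub_sub_cancel ENNReal.one_ne_top ha]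

/-- **`Σ_n P(X_n ≠ X′_n) = ∫_{O ∩ Δᶜ} A(p.1)⁻¹ dμ̂₀ + ∫_{Oᶜ ∩ Δᶜ} A(p.2)⁻¹ dμ̂₀`** in `ℝ≥0∞`, from every initial coupling (standard Borel `Ω`, atom-free
proposal). [ours] -/
theorem tsum_iterate_bind_crnPair_offDiagonal_eq_anyCoupling [StandardBorelSpace Ω] [Nonempty Ω] [MeasurableSingletonClass Ω] [MeasurableEq Ω]
    (hw : Measurable w) (hw0 : ∀ y, 0 < w y) (hq : ∀ x, q {x} = 0) (Khat : Kernel (Ω × Ω) (Ω × Ω)) [IsMarkovKernel Khat]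
    (hK : ∀ z : Ω × Ω, Khat z = (q.prod (volume : Measure unitInterval)).map (fun p : Ω × unitInterval =>
      ((if (p.2 : ℝ) * w z.1 ≤ w p.1 then p.1 else z.1), (if (p.2 : ℝ) * w z.2 ≤ w p.1 then p.1 else z.2))))
    (μ₀ : Measure (Ω × Ω)) [IsFiniteMeasure μ₀] :
    ∑' n, ((fun m : Measure (Ω × Ω) => m.bind Khat)^[n] μ₀) (Set.diagonal Ω)ᶜ =
      ∫⁻ p in {p : Ω × Ω | w p.2 ≤ w p.1} ∩ (Set.diagonal Ω)ᶜ, (imhAcceptMass q w p.1)⁻¹ ∂μ₀ +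
        ∫⁻ p in {p : Ω × Ω | w p.2 ≤ w p.1}ᶜ ∩ (Set.diagonal Ω)ᶜ, (imhAcceptMass q w p.2)⁻¹ ∂μ₀ := by
  have hAm : Measurable fun x : Ω => imhAcceptMass q w x := measurable_imhAcceptMass q hw
  have h1 : ∀ n : ℕ, AEMeasurable (fun p : Ω × Ω => (1 - imhAcceptMass q w p.1) ^ n)
      (μ₀.restrict ({p : Ω × Ω | w p.2 ≤ w p.1} ∩ (Set.diagonal Ω)ᶜ)) := fun n =>
    ((measurable_const.sub (hAm.comp measurable_fst)).pow_const n).aemeasurable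
  have h2 : ∀ n : ℕ, AEMeasurable (fun p : Ω × Ω => (1 - imhAcceptMass q w p.2) ^ n)
      (μ₀.restrict ({p : Ω × Ω | w p.2 ≤ w p.1}ᶜ ∩ (Set.diagonal Ω)ᶜ)) := fun n =>
    ((measurable_const.sub (hAm.comp measurable_snd)).pow_const n).aemeasurable
  simp_rw [iterate_bind_crnPair_offDiagonal_eq_anyCoupling hw hw0 hq Khat hK _ μ₀]
  rw [ENNReal.tsum_add, ← lintegral_tsum h1, ← lintegral_tsum h2]
  congr 1
  · refine lintegral_congr fun p => ?_
    exact ENNReal.tsum_one_sub_pow_eq_inv (imhAcceptMass_le_one (q := q) (w := w) p.1)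
  · refine lintegral_congr fun p => ?_
    exact ENNReal.tsum_one_sub_pow_eq_inv (imhAcceptMass_le_one (q := q) (w := w) p.2)

/-- **`E[T] = E[1/A(heavier of X_0, X′_0) ; X_0 ≠ X′_0]` EXACTLY** (as the real value of the extended-real integral), from every initial coupling:
standard Borel `Ω`, atom-free proposal, `w` normalised and maximal at some `x₀`. [ours] -/
theorem crn_chain_integral_totalDisagreement_eq_anyCoupling [StandardBorelSpace Ω] [Nonempty Ω] [MeasurableSingletonClass Ω] [MeasurableEq Ω]
    (hw : Measurable w) (hw0 : ∀ y, 0 < w y) {x₀ : Ω} (hmax : ∀ y, w y ≤ w x₀) [IsProbabilityMeasure (q.withDensity fun y => ENNReal.ofReal (w y))]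
    (hq : ∀ x, q {x} = 0) (Khat : Kernel (Ω × Ω) (Ω × Ω)) [IsMarkovKernel Khat]
    (hK : ∀ z : Ω × Ω, Khat z = (q.prod (volume : Measure unitInterval)).map (fun p : Ω × unitInterval =>
      ((if (p.2 : ℝ) * w z.1 ≤ w p.1 then p.1 else z.1), (if (p.2 : ℝ) * w z.2 ≤ w p.1 then p.1 else z.2))))
    (μ₀ : Measure (Ω × Ω)) [IsProbabilityMeasure μ₀] :
    ∫ z, (∑' n, (Set.diagonal Ω)ᶜ.indicator (1 : Ω × Ω → ℝ) (z n))
        ∂(Kernel.trajMeasure (X := fun _ : ℕ => Ω × Ω) μ₀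
          (fun n : ℕ => Khat.comap (fun h : (i : ↥(Finset.Iic n)) → Ω × Ω => h ⟨n, Finset.mem_Iic.2 le_rfl⟩)
            (measurable_pi_apply _))) =
      (∫⁻ p in {p : Ω × Ω | w p.2 ≤ w p.1} ∩ (Set.diagonal Ω)ᶜ, (imhAcceptMass q w p.1)⁻¹ ∂μ₀ +
        ∫⁻ p in {p : Ω × Ω | w p.2 ≤ w p.1}ᶜ ∩ (Set.diagonal Ω)ᶜ, (imhAcceptMass q w p.2)⁻¹ ∂μ₀).toReal := by
  obtain ⟨-, heq⟩ := crn_chain_integral_totalDisagreement_eq hw hw0 hmax Khat hK μ₀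
  rw [heq, ← tsum_iterate_bind_crnPair_offDiagonal_eq_anyCoupling hw hw0 hq Khat hK μ₀]
  simp only [measureReal_def]
  refine (ENNReal.tsum_toReal_eq fun n => ?_).symm
  haveI : IsProbabilityMeasure ((fun m : Measure (Ω × Ω) => m.bind Khat)^[n] μ₀) := isProbabilityMeasure_iterate_bind (κ := Khat) μ₀ n
  exact measure_ne_top _ _

end Summit.Ventures.LatticeQCDFlow.Exactness

end
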